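import Literature.NumberTheory.Automorphic.GLnTwoBlockLeviStructure
import Literature.NumberTheory.Rogawski1990.EndoscopicEmbedding
import HarnessLib

/-!
# The two-block standard Levi subgroup of `GL_{k+l}`: the model `GL_k × GL_l ≃ₜ* M_{(ff,…,ff,tt,…,tt)}`
# through `reindexGL finSumFinEquiv ∘ blockDiagGL`, and conjugacy of two reindexings of a block matrix

Topic `NumberTheory/Automorphic`; namespaces `Literature.NumberTheory.Automorphic` (§1–§2) and
`Literature.NumberTheory.Rogawski1990` (§3, docking). KERNEL mathematics only: theorems, no
definition, no named fact, no instance, no notation, no `sorry`. Road «D-N6s» of cell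
`pub/hodgecm-mathlib` (LEAD F0P3a-plan (g8) WORD T7-5 (3)/(4); cut-holder F0P3a-p03 (g9), brick B4′
«the two-block Levi model»): the assembly B5 of the split-place transfer must move the endoscopic
block element `ι(γ_H) = endoGL (g₂, g₁)` (pattern `(* 0 *; 0 * 0; * 0 *)`, ★ `Rogawski1990.endoGL`
`= reindexGL endoPerm ∘ blockDiagGL`) into the STANDARD Levi subgroup `M_c = standardLeviGL F c` of the
monotone two-block labelling `c = (ff, ff, tt)` for which the parabolic descent of orbital integrals
(★ `GLnLeviOrbitalDescent`, Rogawski 1990, Lemma 4.13.1 (a)) is written, and must read `M_c` as the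
topological group `GL_2(F) × GL_1(F)`.  For a commutative topological ring `S` and block sizes `k`, `l`:

* §1 `UnitaryGroup.isConj_reindexGL_reindexGL` — **`reindexGL e g` and `reindexGL e' g` are conjugate
  in `GL_n(S)`** for any two bijections `e, e' : m ≃ n` (conjugation by the permutation matrix of
  `e ∘ e'⁻¹`, Mathlib `PEquiv.toMatrix`); `UnitaryGroup.toBlocks_mul_toBlocks_inv_of_toBlocks_eq_zero`
  — for `u ∈ GL_{n₁ ⊕ n₂}(S)` with vanishing off-diagonal blocks, the diagonal blocks of `u` and of
  `u⁻¹` are mutually inverse (read `u u⁻¹ = 1 = u⁻¹ u` blockwise).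
* §2 `twoBlockLabel_finSumFinEquiv_inl` ∕ `_inr` — the labelling `c₀ : Fin (k + l) → Bool`,
  `c₀ i = decide (k ≤ i)`, is `ff` on the first summand of `finSumFinEquiv : Fin k ⊕ Fin l ≃ Fin (k + l)`
  and `tt` on the second; `reindexGL_finSumFinEquiv_blockDiagGL_mem_standardLeviGL` —
  `reindexGL finSumFinEquiv (blockDiagGL x) ∈ M_{c₀}`;
  **`exists_continuousMulEquiv_prod_standardLeviGL_twoBlock`** — an isomorphism of topological groups
  `e : GL_k(S) × GL_l(S) ≃ₜ* M_{c₀}` with `(e x : GL_{k+l}(S)) = reindexGL finSumFinEquiv (blockDiagGL x)`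
  for all `x` (existence form, no definition introduced; the inverse is «the two diagonal blocks of `g`,
  with inverses the diagonal blocks of `g⁻¹`», continuous for Mathlib's unit-group topology).
* §3 `Rogawski1990.isConj_endoGL_reindexGL_blockDiagGL` — **in `GL_3(S)`, `endoGL x` is conjugate to
  `reindexGL finSumFinEquiv (blockDiagGL x)`** (the `{e₁, e₃} ∕ {e₂}` pattern versus the `{e₁, e₂} ∕ {e₃}`
  pattern: conjugation by the permutation matrix of the transposition `(1 2)`), the docking of ★
  `EndoscopicEmbedding` with §2 at `k = 2`, `l = 1`.

## References

* [BernsteinZelevinsky1977] I. N. Bernstein, A. V. Zelevinsky, *Induced representations of reductive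
  `p`-adic groups I*, Ann. Sci. ÉNS 10 (1977), §2.1 (`M_β ≅ Π GL_{n_i}`).
* [PlatonovRapinchuk1994] V. Platonov, A. Rapinchuk, *Algebraic Groups and Number Theory* (1994), §2.3
  (block-diagonal subgroups of `GL_n`), §3.1 (the topology on points over a topological ring).
* [Rogawski1990] J. D. Rogawski, *Automorphic Representations of Unitary Groups in Three Variables*,
  Ann. of Math. Stud. 123 (1990), §4.8 Case (a) p. 53 (`H = U(2) × U(1)` on the pattern
  `(* 0 *; 0 * 0; * 0 *)`), §4.13 Lemma 4.13.1 (a) pp. 64–66 (descent to a standard Levi `M`).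
* [BourbakiGT1] N. Bourbaki, *General Topology*, Ch. III §2 no. 1 (subgroups and products of
  topological groups).
-/

noncomputable section

open scoped MatrixGroups
open Matrix

namespace Literature.NumberTheory.Automorphic

/-! ### 1. Generic block and reindexing algebra in `GL` -/

section Generic

variable {S : Type*} [CommRing S]

/-- **Two reindexings of the same invertible matrix are conjugate**: for bijections `e, e' : m ≃ n` and
`g ∈ GL_m(S)`, `reindexGL e g` and `reindexGL e' g` are conjugate in `GL_n(S)` — by the permutation
matrix `P_σ` of `σ = e ∘ e'⁻¹` (`P_σ A = A ∘ (σ × id)`, `A P_σ = A ∘ (id × σ⁻¹)`: Mathlib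
`PEquiv.toMatrix_toPEquiv_mul` ∕ `PEquiv.mul_toMatrix_toPEquiv`). [cite: PlatonovRapinchuk1994, §2.3] -/
theorem UnitaryGroup.isConj_reindexGL_reindexGL {m n : Type*} [Fintype m] [DecidableEq m] [Fintype n]
    [DecidableEq n] (e e' : m ≃ n) (g : GL m S) :
    IsConj (UnitaryGroup.reindexGL e g) (UnitaryGroup.reindexGL e' g) := by
  refine isConj_iff.2 ⟨⟨(e'.symm.trans e).toPEquiv.toMatrix, (e'.symm.trans e).symm.toPEquiv.toMatrix,
      by rw [← PEquiv.toMatrix_trans, ← Equiv.toPEquiv_trans, Equiv.self_trans_symm,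
        Equiv.toPEquiv_refl, PEquiv.toMatrix_refl],
      by rw [← PEquiv.toMatrix_trans, ← Equiv.toPEquiv_trans, Equiv.symm_trans_self,
        Equiv.toPEquiv_refl, PEquiv.toMatrix_refl]⟩, ?_⟩
  rw [mul_inv_eq_iff_eq_mul]
  refine Units.ext ?_
  rw [Units.val_mul, Units.val_mul, UnitaryGroup.coe_reindexGL, UnitaryGroup.coe_reindexGL]
  change (e'.symm.trans e).toPEquiv.toMatrix * _ = _ * (e'.symm.trans e).toPEquiv.toMatrix
  rw [PEquiv.toMatrix_toPEquiv_mul, PEquiv.mul_toMatrix_toPEquiv]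
  ext i j
  simp only [Matrix.submatrix_apply, Matrix.reindex_apply, id_eq, Equiv.trans_apply,
    Equiv.symm_trans_apply, Equiv.symm_symm, Equiv.symm_apply_apply]

/-- **The diagonal blocks of a block-diagonal invertible matrix and of its inverse are mutually
inverse**: if `u ∈ GL_{n₁ ⊕ n₂}(S)` has vanishing off-diagonal blocks, then
`u₁₁ (u⁻¹)₁₁ = 1 = (u⁻¹)₁₁ u₁₁` and `u₂₂ (u⁻¹)₂₂ = 1 = (u⁻¹)₂₂ u₂₂` (read `u u⁻¹ = 1 = u⁻¹ u`
blockwise, Mathlib `Matrix.fromBlocks_multiply`). [cite: PlatonovRapinchuk1994, §2.3] -/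
theorem UnitaryGroup.toBlocks_mul_toBlocks_inv_of_toBlocks_eq_zero {n₁ n₂ : Type*} [Fintype n₁]
    [Fintype n₂] [DecidableEq n₁] [DecidableEq n₂] (u : GL (n₁ ⊕ n₂) S)
    (h12 : (u : Matrix (n₁ ⊕ n₂) (n₁ ⊕ n₂) S).toBlocks₁₂ = 0)
    (h21 : (u : Matrix (n₁ ⊕ n₂) (n₁ ⊕ n₂) S).toBlocks₂₁ = 0) :
    (u : Matrix (n₁ ⊕ n₂) (n₁ ⊕ n₂) S).toBlocks₁₁ *
          ((u⁻¹ : GL (n₁ ⊕ n₂) S) : Matrix (n₁ ⊕ n₂) (n₁ ⊕ n₂) S).toBlocks₁₁ = 1 ∧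
      ((u⁻¹ : GL (n₁ ⊕ n₂) S) : Matrix (n₁ ⊕ n₂) (n₁ ⊕ n₂) S).toBlocks₁₁ *
          (u : Matrix (n₁ ⊕ n₂) (n₁ ⊕ n₂) S).toBlocks₁₁ = 1 ∧
      (u : Matrix (n₁ ⊕ n₂) (n₁ ⊕ n₂) S).toBlocks₂₂ *
          ((u⁻¹ : GL (n₁ ⊕ n₂) S) : Matrix (n₁ ⊕ n₂) (n₁ ⊕ n₂) S).toBlocks₂₂ = 1 ∧
      ((u⁻¹ : GL (n₁ ⊕ n₂) S) : Matrix (n₁ ⊕ n₂) (n₁ ⊕ n₂) S).toBlocks₂₂ *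
          (u : Matrix (n₁ ⊕ n₂) (n₁ ⊕ n₂) S).toBlocks₂₂ = 1 := by
  have hUe : (u : Matrix (n₁ ⊕ n₂) (n₁ ⊕ n₂) S) =
      Matrix.fromBlocks (u : Matrix (n₁ ⊕ n₂) (n₁ ⊕ n₂) S).toBlocks₁₁ 0 0
        (u : Matrix (n₁ ⊕ n₂) (n₁ ⊕ n₂) S).toBlocks₂₂ := by
    conv_lhs => rw [← Matrix.fromBlocks_toBlocks (u : Matrix (n₁ ⊕ n₂) (n₁ ⊕ n₂) S)]
    rw [h12, h21]
  have hU'e : ((u⁻¹ : GL (n₁ ⊕ n₂) S) : Matrix (n₁ ⊕ n₂) (n₁ ⊕ n₂) S) =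
      Matrix.fromBlocks ((u⁻¹ : GL (n₁ ⊕ n₂) S) : Matrix (n₁ ⊕ n₂) (n₁ ⊕ n₂) S).toBlocks₁₁
        ((u⁻¹ : GL (n₁ ⊕ n₂) S) : Matrix (n₁ ⊕ n₂) (n₁ ⊕ n₂) S).toBlocks₁₂
        ((u⁻¹ : GL (n₁ ⊕ n₂) S) : Matrix (n₁ ⊕ n₂) (n₁ ⊕ n₂) S).toBlocks₂₁
        ((u⁻¹ : GL (n₁ ⊕ n₂) S) : Matrix (n₁ ⊕ n₂) (n₁ ⊕ n₂) S).toBlocks₂₂ :=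
    (Matrix.fromBlocks_toBlocks _).symm
  have h1 : (u : Matrix (n₁ ⊕ n₂) (n₁ ⊕ n₂) S) * ((u⁻¹ : GL (n₁ ⊕ n₂) S) : Matrix (n₁ ⊕ n₂) (n₁ ⊕ n₂) S) = 1 := by
    rw [← Units.val_mul, mul_inv_cancel, Units.val_one]
  have h2 : ((u⁻¹ : GL (n₁ ⊕ n₂) S) : Matrix (n₁ ⊕ n₂) (n₁ ⊕ n₂) S) * (u : Matrix (n₁ ⊕ n₂) (n₁ ⊕ n₂) S) = 1 := by
    rw [← Units.val_mul, inv_mul_cancel, Units.val_one]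
  rw [hUe, hU'e, Matrix.fromBlocks_multiply, ← Matrix.fromBlocks_one, Matrix.fromBlocks_inj] at h1 h2
  simp only [Matrix.zero_mul, Matrix.mul_zero, add_zero, zero_add] at h1 h2
  exact ⟨h1.1, h2.1, h1.2.2.2, h2.2.2.2⟩

end Generic

/-! ### 2. The two-block labelling `c₀ = (ff^k, tt^l)` and the model `GL_k × GL_l ≃ₜ* M_{c₀}` -/

section TwoBlock

variable (S : Type*) [CommRing S] (k l : ℕ)

/-- The two-block labelling `i ↦ [k ≤ i]` of `Fin (k + l)` is `ff` on the image of `Fin k`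
(`finSumFinEquiv (inl a) = castAdd l a < k`). [cite: BernsteinZelevinsky1977, §2.1] -/
theorem twoBlockLabel_finSumFinEquiv_inl (a : Fin k) :
    decide (k ≤ ((finSumFinEquiv (Sum.inl a) : Fin (k + l)) : ℕ)) = false := by
  rw [finSumFinEquiv_apply_left, Fin.val_castAdd]
  exact decide_eq_false (not_le.mpr a.isLt)

/-- The two-block labelling `i ↦ [k ≤ i]` of `Fin (k + l)` is `tt` on the image of `Fin l`
(`finSumFinEquiv (inr b) = natAdd k b ≥ k`). [cite: BernsteinZelevinsky1977, §2.1] -/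
theorem twoBlockLabel_finSumFinEquiv_inr (b : Fin l) :
    decide (k ≤ ((finSumFinEquiv (Sum.inr b) : Fin (k + l)) : ℕ)) = true := by
  rw [finSumFinEquiv_apply_right, Fin.val_natAdd]
  exact decide_eq_true (Nat.le_add_right k b)

variable {S k l} in
/-- **`reindexGL finSumFinEquiv (diag(x₁, x₂)) ∈ M_{c₀}`**: the reindexed block-diagonal matrix is block
diagonal for the two-block labelling `c₀ i = [k ≤ i]` (its `(i, j)` entry vanishes when `i`, `j` lie in
different summands of `Fin k ⊕ Fin l ≃ Fin (k + l)`). [cite: BernsteinZelevinsky1977, §2.1] -/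
theorem reindexGL_finSumFinEquiv_blockDiagGL_mem_standardLeviGL (x : GL (Fin k) S × GL (Fin l) S) :
    UnitaryGroup.reindexGL finSumFinEquiv (UnitaryGroup.blockDiagGL x) ∈
      standardLeviGL S (fun i : Fin (k + l) => decide (k ≤ (i : ℕ))) := by
  rw [mem_standardLeviGL_iff]
  intro i j hij
  obtain ⟨s, rfl⟩ := finSumFinEquiv.surjective i
  obtain ⟨t, rfl⟩ := finSumFinEquiv.surjective j
  rw [UnitaryGroup.coe_reindexGL, Matrix.reindex_apply, Matrix.submatrix_apply, Equiv.symm_apply_apply,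
    Equiv.symm_apply_apply, UnitaryGroup.coe_blockDiagGL]
  rcases s with a | b <;> rcases t with a' | b'
  · exfalso; apply hij
    rw [twoBlockLabel_finSumFinEquiv_inl, twoBlockLabel_finSumFinEquiv_inl]
  · rfl
  · rfl
  · exfalso; apply hij
    rw [twoBlockLabel_finSumFinEquiv_inr, twoBlockLabel_finSumFinEquiv_inr]

variable [TopologicalSpace S] [IsTopologicalRing S]

/-- **The two-block Levi model**: for the labelling `c₀ : Fin (k + l) → Bool`, `c₀ i = [k ≤ i]`, there
is an isomorphism of topological groups `e : GL_k(S) × GL_l(S) ≃ₜ* M_{c₀}` onto the standard Levi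
subgroup of `GL_{k+l}(S)` whose underlying map is `x ↦ reindexGL finSumFinEquiv (diag(x₁, x₂))` (the
characterising clause; existence form, no definition introduced).  The inverse sends `g ∈ M_{c₀}` to
its two diagonal blocks — units, with inverses the diagonal blocks of `g⁻¹` (§1) — and is continuous
for the unit-group topology because `g ↦ g` and `g ↦ g⁻¹` are (`Units.continuous_iff`).
(Bernstein–Zelevinsky 1977, §2.1: `M_β ≅ GL_{n₁} × GL_{n₂}`; topology: Bourbaki, GT III §2 no. 1.)
[cite: BernsteinZelevinsky1977, §2.1] [cite: PlatonovRapinchuk1994, §2.3]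
[cite: BourbakiGT1, Ch. III §2 no. 1] -/
theorem exists_continuousMulEquiv_prod_standardLeviGL_twoBlock :
    ∃ e : (GL (Fin k) S × GL (Fin l) S) ≃ₜ*
        ↥(standardLeviGL S (fun i : Fin (k + l) => decide (k ≤ (i : ℕ)))),
      ∀ x, ((e x : ↥(standardLeviGL S (fun i : Fin (k + l) => decide (k ≤ (i : ℕ))))) :
          GL (Fin (k + l)) S) = UnitaryGroup.reindexGL finSumFinEquiv (UnitaryGroup.blockDiagGL x) := by
  -- the forward homomorphism `φ = reindexGL E ∘ blockDiagGL`, `E = finSumFinEquiv`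
  have hφmem : ∀ x : GL (Fin k) S × GL (Fin l) S,
      ((UnitaryGroup.reindexGL finSumFinEquiv).comp UnitaryGroup.blockDiagGL) x ∈
        standardLeviGL S (fun i : Fin (k + l) => decide (k ≤ (i : ℕ))) := fun x =>
    reindexGL_finSumFinEquiv_blockDiagGL_mem_standardLeviGL x
  -- off-diagonal blocks of the pull-back `U g = reindex E⁻¹ E⁻¹ g` of `g ∈ M_{c₀}` vanish
  have h12 : ∀ g : ↥(standardLeviGL S (fun i : Fin (k + l) => decide (k ≤ (i : ℕ)))),
      ((UnitaryGroup.reindexGL finSumFinEquiv.symm (g : GL (Fin (k + l)) S) : GL (Fin k ⊕ Fin l) S) :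
        Matrix (Fin k ⊕ Fin l) (Fin k ⊕ Fin l) S).toBlocks₁₂ = 0 := fun g => by
    ext a b
    simp only [Matrix.toBlocks₁₂, Matrix.of_apply, UnitaryGroup.coe_reindexGL, Matrix.reindex_apply,
      Matrix.submatrix_apply, Equiv.symm_symm, Matrix.zero_apply]
    refine (mem_standardLeviGL_iff _ _).1 g.2 _ _ ?_
    rw [twoBlockLabel_finSumFinEquiv_inl, twoBlockLabel_finSumFinEquiv_inr]
    decide
  have h21 : ∀ g : ↥(standardLeviGL S (fun i : Fin (k + l) => decide (k ≤ (i : ℕ)))),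
      ((UnitaryGroup.reindexGL finSumFinEquiv.symm (g : GL (Fin (k + l)) S) : GL (Fin k ⊕ Fin l) S) :
        Matrix (Fin k ⊕ Fin l) (Fin k ⊕ Fin l) S).toBlocks₂₁ = 0 := fun g => by
    ext b a
    simp only [Matrix.toBlocks₂₁, Matrix.of_apply, UnitaryGroup.coe_reindexGL, Matrix.reindex_apply,
      Matrix.submatrix_apply, Equiv.symm_symm, Matrix.zero_apply]
    refine (mem_standardLeviGL_iff _ _).1 g.2 _ _ ?_
    rw [twoBlockLabel_finSumFinEquiv_inl, twoBlockLabel_finSumFinEquiv_inr]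
    decide
  -- the diagonal blocks of `U g` and of `U g⁻¹ = (U g)⁻¹` are mutually inverse
  have key : ∀ g : ↥(standardLeviGL S (fun i : Fin (k + l) => decide (k ≤ (i : ℕ)))),
      ((UnitaryGroup.reindexGL finSumFinEquiv.symm (g : GL (Fin (k + l)) S) : GL (Fin k ⊕ Fin l) S) :
            Matrix (Fin k ⊕ Fin l) (Fin k ⊕ Fin l) S).toBlocks₁₁ *
          ((UnitaryGroup.reindexGL finSumFinEquiv.symm ((g : GL (Fin (k + l)) S)⁻¹) : GL (Fin k ⊕ Fin l) S) :
            Matrix (Fin k ⊕ Fin l) (Fin k ⊕ Fin l) S).toBlocks₁₁ = 1 ∧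
      ((UnitaryGroup.reindexGL finSumFinEquiv.symm ((g : GL (Fin (k + l)) S)⁻¹) : GL (Fin k ⊕ Fin l) S) :
            Matrix (Fin k ⊕ Fin l) (Fin k ⊕ Fin l) S).toBlocks₁₁ *
          ((UnitaryGroup.reindexGL finSumFinEquiv.symm (g : GL (Fin (k + l)) S) : GL (Fin k ⊕ Fin l) S) :
            Matrix (Fin k ⊕ Fin l) (Fin k ⊕ Fin l) S).toBlocks₁₁ = 1 ∧
      ((UnitaryGroup.reindexGL finSumFinEquiv.symm (g : GL (Fin (k + l)) S) : GL (Fin k ⊕ Fin l) S) :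
            Matrix (Fin k ⊕ Fin l) (Fin k ⊕ Fin l) S).toBlocks₂₂ *
          ((UnitaryGroup.reindexGL finSumFinEquiv.symm ((g : GL (Fin (k + l)) S)⁻¹) : GL (Fin k ⊕ Fin l) S) :
            Matrix (Fin k ⊕ Fin l) (Fin k ⊕ Fin l) S).toBlocks₂₂ = 1 ∧
      ((UnitaryGroup.reindexGL finSumFinEquiv.symm ((g : GL (Fin (k + l)) S)⁻¹) : GL (Fin k ⊕ Fin l) S) :
            Matrix (Fin k ⊕ Fin l) (Fin k ⊕ Fin l) S).toBlocks₂₂ *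
          ((UnitaryGroup.reindexGL finSumFinEquiv.symm (g : GL (Fin (k + l)) S) : GL (Fin k ⊕ Fin l) S) :
            Matrix (Fin k ⊕ Fin l) (Fin k ⊕ Fin l) S).toBlocks₂₂ = 1 := fun g => by
    rw [map_inv]
    exact UnitaryGroup.toBlocks_mul_toBlocks_inv_of_toBlocks_eq_zero _ (h12 g) (h21 g)
  -- `U g` is the block-diagonal matrix of its diagonal blocks
  have hUe : ∀ g : ↥(standardLeviGL S (fun i : Fin (k + l) => decide (k ≤ (i : ℕ)))),
      ((UnitaryGroup.reindexGL finSumFinEquiv.symm (g : GL (Fin (k + l)) S) : GL (Fin k ⊕ Fin l) S) :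
          Matrix (Fin k ⊕ Fin l) (Fin k ⊕ Fin l) S) =
        Matrix.fromBlocks
          ((UnitaryGroup.reindexGL finSumFinEquiv.symm (g : GL (Fin (k + l)) S) : GL (Fin k ⊕ Fin l) S) :
            Matrix (Fin k ⊕ Fin l) (Fin k ⊕ Fin l) S).toBlocks₁₁ 0 0
          ((UnitaryGroup.reindexGL finSumFinEquiv.symm (g : GL (Fin (k + l)) S) : GL (Fin k ⊕ Fin l) S) :
            Matrix (Fin k ⊕ Fin l) (Fin k ⊕ Fin l) S).toBlocks₂₂ := fun g => by
    conv_lhs => rw [← Matrix.fromBlocks_toBlocks ((UnitaryGroup.reindexGL finSumFinEquiv.symm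
      (g : GL (Fin (k + l)) S) : GL (Fin k ⊕ Fin l) S) : Matrix (Fin k ⊕ Fin l) (Fin k ⊕ Fin l) S)]
    rw [h12, h21]
  refine ⟨{ toFun := fun x => ⟨((UnitaryGroup.reindexGL finSumFinEquiv).comp UnitaryGroup.blockDiagGL) x, hφmem x⟩
            invFun := fun g =>
              (⟨_, _, (key g).1, (key g).2.1⟩, ⟨_, _, (key g).2.2.1, (key g).2.2.2⟩)
            left_inv := fun x => ?_
            right_inv := fun g => ?_
            map_mul' := fun x y => Subtype.ext (map_mul _ x y)
            continuous_toFun :=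
              ((UnitaryGroup.continuous_reindexGL finSumFinEquiv).comp
                UnitaryGroup.continuous_blockDiagGL).subtype_mk _
            continuous_invFun := ?_ }, fun x => rfl⟩
  · -- `left_inv`: the diagonal blocks of `U (φ x) = diag(x₁, x₂)` are `x₁`, `x₂`
    have hx : ((UnitaryGroup.reindexGL finSumFinEquiv.symm
        ((((UnitaryGroup.reindexGL finSumFinEquiv).comp UnitaryGroup.blockDiagGL) x :
          GL (Fin (k + l)) S)) : GL (Fin k ⊕ Fin l) S) : Matrix (Fin k ⊕ Fin l) (Fin k ⊕ Fin l) S) =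
        Matrix.fromBlocks (x.1 : Matrix (Fin k) (Fin k) S) 0 0 (x.2 : Matrix (Fin l) (Fin l) S) := by
      change Matrix.reindex finSumFinEquiv.symm finSumFinEquiv.symm (Matrix.reindex finSumFinEquiv finSumFinEquiv
        (Matrix.fromBlocks (x.1 : Matrix (Fin k) (Fin k) S) 0 0 (x.2 : Matrix (Fin l) (Fin l) S))) = _
      rw [← Matrix.reindex_symm, Equiv.symm_apply_apply]
    refine Prod.ext (Units.ext ?_) (Units.ext ?_)
    · change ((UnitaryGroup.reindexGL finSumFinEquiv.symm
        ((((UnitaryGroup.reindexGL finSumFinEquiv).comp UnitaryGroup.blockDiagGL) x :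
          GL (Fin (k + l)) S)) : GL (Fin k ⊕ Fin l) S) : Matrix (Fin k ⊕ Fin l) (Fin k ⊕ Fin l) S).toBlocks₁₁ = _
      rw [hx, Matrix.toBlocks_fromBlocks₁₁]
    · change ((UnitaryGroup.reindexGL finSumFinEquiv.symm
        ((((UnitaryGroup.reindexGL finSumFinEquiv).comp UnitaryGroup.blockDiagGL) x :
          GL (Fin (k + l)) S)) : GL (Fin k ⊕ Fin l) S) : Matrix (Fin k ⊕ Fin l) (Fin k ⊕ Fin l) S).toBlocks₂₂ = _
      rw [hx, Matrix.toBlocks_fromBlocks₂₂]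
  · -- `right_inv`: `reindex E E (diag(U g₁₁, U g₂₂)) = reindex E E (U g) = g`
    refine Subtype.ext (Units.ext ?_)
    change Matrix.reindex finSumFinEquiv finSumFinEquiv (Matrix.fromBlocks
      ((UnitaryGroup.reindexGL finSumFinEquiv.symm (g : GL (Fin (k + l)) S) : GL (Fin k ⊕ Fin l) S) :
        Matrix (Fin k ⊕ Fin l) (Fin k ⊕ Fin l) S).toBlocks₁₁ 0 0
      ((UnitaryGroup.reindexGL finSumFinEquiv.symm (g : GL (Fin (k + l)) S) : GL (Fin k ⊕ Fin l) S) :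
        Matrix (Fin k ⊕ Fin l) (Fin k ⊕ Fin l) S).toBlocks₂₂) = ((g : GL (Fin (k + l)) S) : Matrix _ _ S)
    rw [← hUe g, UnitaryGroup.coe_reindexGL, ← Matrix.reindex_symm, Equiv.apply_symm_apply]
  · -- continuity of the inverse: the blocks of `U g` and of `U g⁻¹` depend continuously on `g`
    have hU : Continuous fun g : ↥(standardLeviGL S (fun i : Fin (k + l) => decide (k ≤ (i : ℕ)))) =>
        ((UnitaryGroup.reindexGL finSumFinEquiv.symm (g : GL (Fin (k + l)) S) : GL (Fin k ⊕ Fin l) S) :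
          Matrix (Fin k ⊕ Fin l) (Fin k ⊕ Fin l) S) :=
      Units.continuous_val.comp ((UnitaryGroup.continuous_reindexGL finSumFinEquiv.symm).comp
        continuous_subtype_val)
    have hU' : Continuous fun g : ↥(standardLeviGL S (fun i : Fin (k + l) => decide (k ≤ (i : ℕ)))) =>
        ((UnitaryGroup.reindexGL finSumFinEquiv.symm ((g : GL (Fin (k + l)) S)⁻¹) : GL (Fin k ⊕ Fin l) S) :
          Matrix (Fin k ⊕ Fin l) (Fin k ⊕ Fin l) S) :=
      Units.continuous_val.comp ((UnitaryGroup.continuous_reindexGL finSumFinEquiv.symm).comp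
        (continuous_inv.comp continuous_subtype_val))
    refine Continuous.prodMk (Units.continuous_iff.2 ⟨?_, ?_⟩) (Units.continuous_iff.2 ⟨?_, ?_⟩)
    · exact continuous_matrix fun i j => hU.matrix_elem (Sum.inl i) (Sum.inl j)
    · exact continuous_matrix fun i j => hU'.matrix_elem (Sum.inl i) (Sum.inl j)
    · exact continuous_matrix fun i j => hU.matrix_elem (Sum.inr i) (Sum.inr j)
    · exact continuous_matrix fun i j => hU'.matrix_elem (Sum.inr i) (Sum.inr j)

end TwoBlock

end Literature.NumberTheory.Automorphic

/-! ### 3. Docking with the endoscopic pattern: `endoGL x ∼ reindexGL finSumFinEquiv (blockDiagGL x)` in `GL_3` -/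

namespace Literature.NumberTheory.Rogawski1990

open Literature.NumberTheory.Automorphic

/-- **The `{e₁, e₃} ∕ {e₂}` pattern and the `{e₁, e₂} ∕ {e₃}` pattern are conjugate**: for
`x = (g₂, g₁) ∈ GL_2(S) × GL_1(S)`, the endoscopic block element `endoGL x = (* 0 *; 0 * 0; * 0 *)`
(★ `endoGL = reindexGL endoPerm ∘ blockDiagGL`, `endoPerm = finSumFinEquiv ∘ (1 2)`) is conjugate in
`GL_3(S)` to `reindexGL finSumFinEquiv (diag(g₂, g₁)) = (g₂ 0; 0 g₁)`, an element of the standard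
two-block Levi subgroup `M_{(ff, ff, tt)}` (§2) — conjugation by the permutation matrix of the
transposition `(1 2)`. (Rogawski 1990, §4.8 Case (a) p. 53: «we regard elements of `H` as elements of
`G`»; §4.13: the Levi `M` of type `(2, 1)`.) [cite: Rogawski1990, §4.8 Case (a) p. 53]
[cite: PlatonovRapinchuk1994, §2.3] -/
theorem isConj_endoGL_reindexGL_blockDiagGL {S : Type*} [CommRing S] (x : GL (Fin 2) S × GL (Fin 1) S) :
    IsConj (endoGL x) (UnitaryGroup.reindexGL finSumFinEquiv (UnitaryGroup.blockDiagGL x)) :=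
  UnitaryGroup.isConj_reindexGL_reindexGL endoPerm finSumFinEquiv (UnitaryGroup.blockDiagGL x)

end Literature.NumberTheory.Rogawski1990

end
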